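/-
Copyright (c) 2026. All rights reserved.
Released under Apache 2.0 license as described in the file LICENSE.
-/
import Literature.AlgebraicGeometry.Pohlmann1968.DegenerateCMTypesAbelianCMFieldExponentFourTimesPrime
import HarnessLib

/-!
# ABELIAN CM fields with Galois group of EXPONENT `2p²` (`(ℤ/2)^r × (ℤ/p)^s × (ℤ/p²)^t`, `p` an odd prime): the rank of every CM type is
# `[K:ℚ]/2 + 1 − b(Φ) − (p − 1)e_{2p}(Φ) − p(p − 1)e_{2p²}(Φ)`; the nondegeneracy criterion and the Hodge conjecture for all powers off
# the three lists; `ℚ(ζ₅₇), ℚ(ζ₇₆), ℚ(ζ₁₀₈)` (`Rank + b + 2e₆ + 6e₁₈ = 19`)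

Topic `Literature/AlgebraicGeometry/Pohlmann1968` (namespace `Literature.AlgebraicGeometry.Pohlmann1968.ExponentTwicePrimeSquare`); cell
`pub-hodgecm2` (COR-CM), KEPT Literature lane `lit-deligne-3` gen 64, file F64c (first step into the «φ(N) = 36» band: the levels `57, 76, 108`
have `(ℤ/N)ˣ ≅ ℤ/2 × ℤ/18`, exponent `18 = 2·3²`; the levels `63, 126` have `(ℤ/N)ˣ ≅ ℤ/6 × ℤ/6` of exponent `6` and fall under F64a
`ExponentTwicePrime`; `37, 74` (`ℤ/36`, exponent `4·3²`) remain).  KERNEL ONLY: theorems; no `def`, no named fact, no instance, no notation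
(D-0014 ∕ D-0026 net debt `0`).  HC_CM is NOT proved here or anywhere in the lane.

## Mathematics

T. Kubota [Kubota1965], §4 LEMMA 2 (defect = number of vanishing odd characters), grouped by KERNEL (S. P. White; tree
`DegenerateCMTypesAbelianKernels.typeRank_add_sum_totient_eq`).  If `g^{2p²} = 1` on `G = Gal(K/ℚ)` then an admissible kernel (`ρ ∉ H`,
`G/H` cyclic) has index `2`, `2p` or `2p²` (`index_eq_of_isCyclic_quotient`: `[G:H]` divides `2p²` and is even), and the tree DECIDES all
three: index `2` — even split (Weil type over the imaginary quadratic `K^H`, Dodson [Dodson1984] §3.1.1); index `2p^{a+1}` (`a = 0, 1`) —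
`S` EQUIDISTRIBUTED along the subgroup of order `p` of `G/H ≅ ℤ/2p^{a+1}` (`#(S ∩ gxH) = #(S ∩ gH)` for `x^p ∈ H`; Hazama's Lemma 4.6.1
mechanism [Hazama2003CyclicCM], Dodson's LEVEL ∕ DIRECTION criteria on `⟨ρ⟩ × ℤ_{p^k}` [Dodson1987] Prop. 4.4; tree
`…equidistributed_of_index`).  Every index-`2p` subgroup has cyclic quotient; an index-`2p²` subgroup need not (`ℤ/2 × ℤ/p × ℤ/p`), so
the cyclicity clause is part of the third count.  Hence, EXACTLY,

  `[K:ℚ]/2 + 1 − Rank(Φ) = b(Φ) + (p − 1)·e_{2p}(Φ) + p(p − 1)·e_{2p²}(Φ)`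

with `b(Φ) = #{F ⊆ K imaginary quadratic : Φ balanced (Weil type) over F}`, `e_{2p}(Φ) = #{F ⊆ K : [F:ℚ] = 2p, F CM, Φ LEVEL of exponent
p over F}`, `e_{2p²}(Φ) = #{F ⊆ K : [F:ℚ] = 2p², F CM, Gal(F/ℚ) CYCLIC, Φ level of exponent p over F}` (for every `σ ∈ Gal(F/ℚ)` with
`σ^p = 1` and every `τ : F → ℂ`, `#{φ ∈ Φ : φ|_F = τ ∘ σ} = #{φ ∈ Φ : φ|_F = τ}`).

* §1 GROUP LEVEL: **`index_eq_of_isCyclic_quotient`** (`2 ∨ 2p ∨ 2p²`), **`typeRank_add_card_kernels_eq`** (`rank(T) + #B₂ + (p−1)·#B_{2p} +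
  p(p−1)·#B_{2p²} = |G|/2 + 1`), **`typeRank_eq_iff`**.
* §2 FIELD LEVEL: `cmTypeRank_add_card_kernels_eq` (on `Gal`), **`cmTypeRank_add_ncard_subfields_eq`** (THE INTRINSIC RANK FORMULA),
  **`isNondegenerate_iff_forall_intermediateField`**, `not_isNondegenerate_of_level_of_isCyclic`.
* §3 ABELIAN VARIETIES: `B•(Aⁿ) ⊗ ℂ = D•(Aⁿ) ⊗ ℂ` and the Hodge conjecture for every power of every realisation of a type off the three lists
  (**`hodgeConjectureFor_pow_of_forall_intermediateField`**, `hodgeClassSpan_pow_eq_divisorClassesSpan_of_forall_intermediateField`,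
  `not_exists_exceptional_pow_of_forall_intermediateField`) — UNCONDITIONAL.
* §4 CYCLOTOMIC FIELDS `ℚ(ζ_q)` with `u^{2p²} = 1` on `(ℤ/q)ˣ` (`…_of_isCyclotomicExtension`, via the neighbour's
  `ExponentFourTimesPrime.cm_abelian_pow_eq_one_of_isCyclotomicExtension`); the levels `57, 76, 108` (`(ℤ/N)ˣ ≅ ℤ/2 × ℤ/18`, `φ = 36`):
  `units_pow_eighteen_fiftySeven ∕ seventySix ∕ oneHundredEight` (kernel decision on residues, `decide +kernel`),
  **`cmTypeRank_add_ncard_subfields_fiftySeven ∕ seventySix ∕ oneHundredEight`** (`Rank(Φ) + b + 2e₆ + 6e₁₈ = 19` for EVERY CM type),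
  **`hodgeConjectureFor_pow_of_forall_fiftySeven ∕ seventySix ∕ oneHundredEight`**.

NUMERICAL PICTURE (offline census of this seat, NOT a theorem of this file; `lane/census_np.py 2,18 1,0`, kit job `j338350`, validated on
`ℤ/2 × ℤ/12` against the lane's pure-Python census): for `G = ℤ/2 × ℤ/18 ∋ ρ = (1,0)` (the class of `−1` in `(ℤ/N)ˣ` for `N = 57, 76, 108`
up to automorphism), `n = 18`, `2¹⁸ = 262144` types, the triples `(b, e₆, e₁₈)` and ranks are — PRIMITIVE (`261072` types): `(0,0,0)` rank `19`
(NONDEGENERATE): `155016`; `(1,0,0)` `18`: `78984`; `(0,1,0)` `17`: `9072`; `(1,1,0)` `16`: `14112`; `(0,2,0)` `15`: `216`; `(1,2,0)` `14`: `2808`;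
`(0,0,1)` `13`: `576`; `(1,0,1)` `12`: `288` — imprimitive (`1072` types): `(1,1,1)` `10`: `900`; `(1,2,1)` `8`: `108`; `(0,0,2)` `7`: `24`;
`(1,0,2)` `6`: `24`; `(1,1,2)` `4`: `12`; `(1,2,2)` `2`: `4`.  So all three families occur on PRIMITIVE types of `ℚ(ζ₅₇)` (`864` primitive types are
level over a cyclic CM subfield of degree `18`), `b ≤ 1` throughout, and §3 covers exactly the `155016` nondegenerate types (simple CM `18`-folds
with `B = D` on all powers).

PRESEARCH (lane rule): as for the neighbours `ExponentTwicePrime` ∕ `ExponentFourTimesPrime` (corpus hybrid + vector; galaxy «degenerate CM type |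
degenerate CM-type | nondegenerate CM type», all stars: no statement of the formula) — Kubota's Lemma 2 regrouped by kernels with Dodson's index-`2`
and Hazama's ∕ Dodson's index-`2p^{a+1}` criteria; recorded as the lane's own elementary theorem with those citations.

HONEST REGISTER.  Everything here is unconditional and elementary given the tree's Kubota ∕ Hazama ∕ Pohlmann theorems.  Nothing is claimed for
the DEGENERATE types (for them `Bᵐ ⊋ Dᵐ` in some degree — Lenstra, tree `AbelianCMField.exists_exceptional_of_oddCharacter` — and the Hodge
conjecture is OPEN in print); HC_CM is NOT proved and not used.

## References

* [Kubota1965] T. Kubota, *On the field extension by complex multiplication*, Trans. AMS 118 (1965), §4 Lemma 2.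
* [White1993SporadicCycles] S. P. White, *Sporadic cycles on CM abelian varieties*, Compositio Math. 88 (1993), §4, proof of Lemma 3 (p. 131).
* [Dodson1984] B. Dodson, *The structure of Galois groups of CM-fields*, Trans. AMS 283 (1984), §3.1.1 Theorem.
* [Dodson1987] B. Dodson, *On the Mumford–Tate group of an abelian variety with complex multiplication*, J. Algebra 111 (1987), Prop. 4.4.
* [Hazama2003CyclicCM] F. Hazama, *Hodge cycles on abelian varieties with complex multiplication by cyclic CM-fields*, J. Math. Sci. Univ.
  Tokyo 10 (2003), Prop. 4.3, Lemma 4.6.1.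
* [Gordon1999HodgeAVSurvey] B. B. Gordon, *A survey of the Hodge conjecture for abelian varieties*, 5.13 (ii), Thm. 6.4, §9.3, 9.4.1.
* [Yanai2015IndexDegeneracy] H. Yanai, *On the index of degeneracy of a CM-type*, Thm. 4.1 (proof, p. 818).
* [Washington1997] L. C. Washington, *Introduction to Cyclotomic Fields*, Ch. 2, Thm. 2.5.
* [Deligne2000] P. Deligne, *The Hodge conjecture* (Clay, 2000), §1.

## Provenance

Cell `pub-hodgecm2` (COR-CM), KEPT Literature lane `lit-deligne-3` gen 64 (claim ABELIAN-EXPONENT-2P2-RANK-FORMULA; count-neutral, own lane), file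
F64c; neighbours cited by name, nothing restated: `DegenerateCMTypesAbelianKernels` (group level), `DegenerateCMTypesAbelianCMFieldCyclicSubfields`
(`card_indexTwo_eq_ncard_weilQuadratic`), `DegenerateCMTypesAbelianCMFieldExponentTwicePrime` (`card_index_eq_ncard_level`),
`DegenerateCMTypesAbelianCMFieldExponentFourTimesPrime` (`card_index_isCyclic_eq_ncard_level`, `cm_abelian_pow_eq_one_of_isCyclotomicExtension`),
`NondegenerateCMTypeDivisorClasses` (`IsNondegenerate.hodgeClassSpan_pow_eq_divisorClassesSpan`).  Theorems only; net Literature debt 0.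
-/

noncomputable section

open scoped BigOperators NumberField IsMulCommutative Classical
open NumberField IntermediateField

namespace Literature.AlgebraicGeometry.Pohlmann1968

namespace ExponentTwicePrimeSquare

open Literature.NumberTheory.ComplexMultiplication
open Literature.NumberTheory.ComplexMultiplication.CMNumbers
open Literature.AlgebraicGeometry.Motives (CMType)
open Literature.AlgebraicGeometry.Pohlmann1968.CyclicTwoOddPrimes (isCMTypeWith_galType cmTypeRank_eq_typeRank_galType)
open Literature.AlgebraicGeometry.Pohlmann1968.AbelianKernels
open Literature.AlgebraicGeometry.Pohlmann1968.ExponentTwicePrime (forall_card_filter_eq_iff_level card_index_eq_ncard_level)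
open Literature.AlgebraicGeometry.Pohlmann1968.ExponentFourTimesPrime (card_index_isCyclic_eq_ncard_level
  cm_abelian_pow_eq_one_of_isCyclotomicExtension)

/-! ## §0 Arithmetic helper -/

/-- If `a + b + kc + ld = n` with `k, l ≠ 0` (naturals) then `a = n ↔ b = c = d = 0`. [folklore] -/
private theorem eq_iff_of_add_eq₂ₚ₂ {a b c d k l n : ℕ} (hk : k ≠ 0) (hl : l ≠ 0) (h : a + b + k * c + l * d = n) :
    a = n ↔ b = 0 ∧ c = 0 ∧ d = 0 := by
  set u := k * c with hu
  set v := l * d with hv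
  have hu0 : u = 0 ↔ c = 0 := by rw [hu, Nat.mul_eq_zero]; omega
  have hv0 : v = 0 ↔ d = 0 := by rw [hv, Nat.mul_eq_zero]; omega
  constructor
  · intro ha
    exact ⟨by omega, hu0.1 (by omega), hv0.1 (by omega)⟩
  · rintro ⟨hb, hc, hd⟩
    have := hu0.2 hc
    have := hv0.2 hd
    omega

/-! ## §1 Group level: in exponent `2p²` every admissible kernel has index `2`, `2p` or `2p²` -/

section Group

variable {G : Type*} [CommGroup G] {p : ℕ}

/-- A commutative group of order `2p` (`p` an odd prime) is cyclic. [folklore] -/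
private theorem isCyclic_of_card_eq_two_mul₂ₚ₂ [Finite G] [hp : Fact p.Prime] (hp2 : p ≠ 2) (hG : Nat.card G = 2 * p) :
    IsCyclic G := by
  haveI : Fact (Nat.Prime 2) := ⟨Nat.prime_two⟩
  obtain ⟨x, hx⟩ := exists_prime_orderOf_dvd_card' (G := G) 2 (by rw [hG]; exact dvd_mul_right 2 p)
  obtain ⟨y, hy⟩ := exists_prime_orderOf_dvd_card' (G := G) p (by rw [hG]; exact dvd_mul_left p 2)
  have hcop : Nat.Coprime (orderOf x) (orderOf y) := by
    rw [hx, hy]; exact (Nat.coprime_primes Nat.prime_two hp.out).2 hp2.symm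
  exact isCyclic_of_orderOf_eq_card (x * y)
    (by rw [(Commute.all x y).orderOf_mul_eq_mul_orderOf_of_coprime hcop, hx, hy, hG])

/-- **In a commutative group with `g^{2p²} = 1` for all `g` (`p` an odd prime), a subgroup `H` missing an involution `ρ` and
with CYCLIC quotient has index `2`, `2p` or `2p²`**: `|G/H|` divides `2p²` and is even.  (For index `2p` the quotient is
automatically cyclic; for index `2p²` it need not be: `ℤ/2 × ℤ/p × ℤ/p`.) [cite: Kubota1965, §4 Lemma 2]
[cite: White1993SporadicCycles, §4, proof of Lemma 3 (p. 131)] -/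
theorem index_eq_of_isCyclic_quotient [hp : Fact p.Prime] (hp2 : p ≠ 2) (hexp : ∀ g : G, g ^ (2 * p ^ 2) = 1)
    {H : Subgroup G} {ρ : G} (hρH : ρ ∉ H) (hρ2 : ρ * ρ = 1) (hcyc : IsCyclic (G ⧸ H)) :
    H.index = 2 ∨ H.index = 2 * p ∨ H.index = 2 * p ^ 2 := by
  haveI := hcyc
  have hdvd : H.index ∣ 2 * p ^ 2 := by
    rw [Subgroup.index_eq_card, ← IsCyclic.exponent_eq_card]
    exact Monoid.exponent_dvd_of_forall_pow_eq_one fun q => QuotientGroup.induction_on q fun g => by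
      rw [← QuotientGroup.mk_pow, hexp, QuotientGroup.mk_one]
  have hρ1 : (ρ : G ⧸ H) ≠ 1 := fun h => hρH ((QuotientGroup.eq_one_iff ρ).1 h)
  have hord : orderOf (ρ : G ⧸ H) = 2 := by
    haveI : Fact (Nat.Prime 2) := ⟨Nat.prime_two⟩
    refine orderOf_eq_prime ?_ hρ1
    rw [pow_two, ← QuotientGroup.mk_mul, hρ2, QuotientGroup.mk_one]
  have h2 : 2 ∣ H.index := by rw [Subgroup.index_eq_card, ← hord]; exact orderOf_dvd_natCard _
  have hp2' : ¬ 2 ∣ p := fun h => hp2 ((Nat.prime_dvd_prime_iff_eq Nat.prime_two hp.out).1 h).symm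
  obtain ⟨d₁, d₂, hd₁, hd₂, hdeq⟩ := Nat.dvd_mul.1 hdvd
  obtain ⟨i, hi, rfl⟩ := (Nat.dvd_prime_pow hp.out).1 hd₂
  have hpi : ¬ 2 ∣ p ^ i := fun h => hp2' (Nat.Prime.dvd_of_dvd_pow Nat.prime_two h)
  rcases (Nat.dvd_prime Nat.prime_two).1 hd₁ with rfl | rfl
  · exfalso; rw [← hdeq, one_mul] at h2; exact hpi h2
  · interval_cases i
    · exact Or.inl (by rw [← hdeq, pow_zero, mul_one])
    · exact Or.inr (Or.inl (by rw [← hdeq, pow_one]))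
    · exact Or.inr (Or.inr hdeq.symm)

variable [Fintype G] [DecidableEq G]

/-- **THE RANK OF A CM TYPE IN EXPONENT `2p²` (group level).**  Let `G` be a finite commutative group with `g^{2p²} = 1` for all
`g` (`p` an odd prime; `G ≅ (ℤ/2)^r × (ℤ/p)^s × (ℤ/p²)^t`), `ρ ∈ G` and `T` a CM type (`T ⊔ ρT = G`).  Then

  `rank(T) + #B₂ + (p − 1)·#B_{2p} + p(p − 1)·#B_{2p²} = |G|/2 + 1`,

where `B₂` = the index-`2` subgroups `H ∌ ρ` splitting `T` evenly, `B_{2p}` = the index-`2p` subgroups `H ∌ ρ` (all with cyclic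
quotient) at which `T` is EQUIDISTRIBUTED (`#(T ∩ gxH) = #(T ∩ gH)` for all `g` and all `x` with `x^p ∈ H`), `B_{2p²}` = the
index-`2p²` subgroups `H ∌ ρ` with CYCLIC quotient at which `T` is equidistributed (the same condition: along the subgroup of order `p`
of `G/H ≅ ℤ/2p²`).  Kubota's defect `Σ_H φ([G:H])` (tree `AbelianKernels.typeRank_add_sum_totient_eq`) with the tree's criteria at
index `2` (`…iff_of_index_two`) and `2p^{a+1}` (`…equidistributed_of_index`, `a = 0, 1`); `φ = 1, p − 1, p(p − 1)`.  The
exponent-`2p` case is the neighbour `ExponentTwicePrime.typeRank_add_card_add_mul_card_eq`; the case `|G| = 2p^k` is the tree's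
`AbelianPrimePow` ∕ `DegenerateCMTypesAbelianCMFieldPrimePower` family. [cite: Kubota1965, §4 Lemma 2]
[cite: Hazama2003CyclicCM, Prop. 4.3 and Lemma 4.6.1] [cite: Dodson1984, §3.1.1 Theorem] [cite: Dodson1987, Prop. 4.4] -/
theorem typeRank_add_card_kernels_eq [hp : Fact p.Prime] (hp2 : p ≠ 2) {ρ : G} {T : Finset G}
    (h : IsCMTypeWith ρ (T : Set G)) (hexp : ∀ g : G, g ^ (2 * p ^ 2) = 1) :
    typeRank G (T : Set G) +
      ((Finset.univ : Finset (Subgroup G)).filter fun H => ρ ∉ H ∧ H.index = 2 ∧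
        (T.filter fun s => s ∈ H).card = (T.filter fun s => s ∉ H).card).card +
      (p - 1) * ((Finset.univ : Finset (Subgroup G)).filter fun H => ρ ∉ H ∧ H.index = 2 * p ∧
        ∀ x : G, x ^ p ∈ H → ∀ g : G,
          (T.filter fun s => (g * x)⁻¹ * s ∈ H).card = (T.filter fun s => g⁻¹ * s ∈ H).card).card +
      p * (p - 1) * ((Finset.univ : Finset (Subgroup G)).filter fun H => ρ ∉ H ∧ H.index = 2 * p ^ 2 ∧ IsCyclic (G ⧸ H) ∧
        ∀ x : G, x ^ p ∈ H → ∀ g : G,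
          (T.filter fun s => (g * x)⁻¹ * s ∈ H).card = (T.filter fun s => g⁻¹ * s ∈ H).card).card =
      Fintype.card G / 2 + 1 := by
  have hρ2 : ρ * ρ = 1 := by simpa [smul_eq_mul] using h.invol (1 : G)
  have hp3 : 3 ≤ p := by
    have := hp.out.two_le
    rcases Nat.lt_or_ge 2 p with h' | h'
    · omega
    · exfalso; exact hp2 (le_antisymm h' this)
  have hq : p * 3 ≤ p ^ 2 := by rw [pow_two]; exact Nat.mul_le_mul_left p hp3
  have h2p : Nat.Coprime 2 p := (Nat.coprime_primes Nat.prime_two hp.out).2 hp2.symm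
  have h2p2 : Nat.Coprime 2 (p ^ 2) := h2p.pow_right 2
  have key := CyclicCMType.AbelianKernels.typeRank_add_sum_totient_eq h
  set A := (Finset.univ : Finset (Subgroup G)).filter (fun H => ρ ∉ H ∧ IsCyclic (G ⧸ H) ∧
    ∀ χ : AddChar (Additive G) ℂ, (∀ g : G, χ (Additive.ofMul g) = 1 ↔ g ∈ H) →
      ∑ s ∈ T, χ (Additive.ofMul s) = 0) with hA
  set B₂ := ((Finset.univ : Finset (Subgroup G)).filter fun H => ρ ∉ H ∧ H.index = 2 ∧
        (T.filter fun s => s ∈ H).card = (T.filter fun s => s ∉ H).card) with hB₂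
  set B' := ((Finset.univ : Finset (Subgroup G)).filter fun H => ρ ∉ H ∧ H.index = 2 * p ∧
        ∀ x : G, x ^ p ∈ H → ∀ g : G,
          (T.filter fun s => (g * x)⁻¹ * s ∈ H).card = (T.filter fun s => g⁻¹ * s ∈ H).card) with hB'
  set B'' := ((Finset.univ : Finset (Subgroup G)).filter fun H => ρ ∉ H ∧ H.index = 2 * p ^ 2 ∧ IsCyclic (G ⧸ H) ∧
        ∀ x : G, x ^ p ∈ H → ∀ g : G,
          (T.filter fun s => (g * x)⁻¹ * s ∈ H).card = (T.filter fun s => g⁻¹ * s ∈ H).card) with hB''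
  -- the admissible kernels of index `2`
  have hA₂ : A.filter (fun H => H.index = 2) = B₂ := by
    rw [hA, hB₂, Finset.filter_filter]
    refine Finset.filter_congr fun H _ => ?_
    constructor
    · rintro ⟨⟨hρH, -, hchar⟩, hidx⟩
      exact ⟨hρH, hidx,
        (CyclicCMType.AbelianKernels.forall_sum_char_eq_zero_iff_of_index_two hρ2 hρH hidx T).1 hchar⟩
    · rintro ⟨hρH, hidx, hsplit⟩
      haveI : Fact (Nat.Prime 2) := ⟨Nat.prime_two⟩
      exact ⟨⟨hρH, isCyclic_of_prime_card (p := 2) (by rw [← Subgroup.index_eq_card, hidx]),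
        (CyclicCMType.AbelianKernels.forall_sum_char_eq_zero_iff_of_index_two hρ2 hρH hidx T).2 hsplit⟩, hidx⟩
  -- the admissible kernels of index `2p`
  have hA' : A.filter (fun H => H.index = 2 * p) = B' := by
    rw [hA, hB', Finset.filter_filter]
    refine Finset.filter_congr fun H _ => ?_
    constructor
    · rintro ⟨⟨hρH, hcyc, hchar⟩, hidx⟩
      have hidx'' : H.index = 2 * p ^ (0 + 1) := by rw [zero_add, pow_one]; exact hidx
      exact ⟨hρH, hidx, (CyclicCMType.AbelianKernels.forall_sum_char_eq_zero_iff_equidistributed_of_index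
        hp2 h hρH hcyc hidx'').1 hchar⟩
    · rintro ⟨hρH, hidx, hE⟩
      have hcyc : IsCyclic (G ⧸ H) :=
        isCyclic_of_card_eq_two_mul₂ₚ₂ hp2 (by rw [← Subgroup.index_eq_card, hidx])
      have hidx'' : H.index = 2 * p ^ (0 + 1) := by rw [zero_add, pow_one]; exact hidx
      exact ⟨⟨hρH, hcyc, (CyclicCMType.AbelianKernels.forall_sum_char_eq_zero_iff_equidistributed_of_index
        hp2 h hρH hcyc hidx'').2 hE⟩, hidx⟩
  -- the admissible kernels of index `2p²`
  have hA'' : A.filter (fun H => H.index = 2 * p ^ 2) = B'' := by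
    rw [hA, hB'', Finset.filter_filter]
    refine Finset.filter_congr fun H _ => ?_
    constructor
    · rintro ⟨⟨hρH, hcyc, hchar⟩, hidx⟩
      have hidx'' : H.index = 2 * p ^ (1 + 1) := by simpa using hidx
      exact ⟨hρH, hidx, hcyc, (CyclicCMType.AbelianKernels.forall_sum_char_eq_zero_iff_equidistributed_of_index
        hp2 h hρH hcyc hidx'').1 hchar⟩
    · rintro ⟨hρH, hidx, hcyc, hE⟩
      have hidx'' : H.index = 2 * p ^ (1 + 1) := by simpa using hidx
      exact ⟨⟨hρH, hcyc, (CyclicCMType.AbelianKernels.forall_sum_char_eq_zero_iff_equidistributed_of_index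
        hp2 h hρH hcyc hidx'').2 hE⟩, hidx⟩
  -- Euler's `φ` on the admissible kernels, pointwise
  have hpt : ∀ H ∈ A, H.index.totient =
      (if H.index = 2 then 1 else 0) + (p - 1) * (if H.index = 2 * p then 1 else 0) +
        p * (p - 1) * (if H.index = 2 * p ^ 2 then 1 else 0) := by
    intro H hH
    rw [hA, Finset.mem_filter] at hH
    obtain ⟨-, hρH, hcyc, -⟩ := hH
    rcases index_eq_of_isCyclic_quotient hp2 hexp hρH hρ2 hcyc with hi | hi | hi <;> rw [hi]
    · rw [if_pos rfl, if_neg (by omega : (2 : ℕ) ≠ 2 * p), if_neg (by omega : (2 : ℕ) ≠ 2 * p ^ 2), Nat.totient_two]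
      simp
    · rw [if_neg (by omega : 2 * p ≠ 2), if_pos rfl, if_neg (by omega : 2 * p ≠ 2 * p ^ 2), Nat.totient_mul h2p,
        Nat.totient_two, Nat.totient_prime hp.out]
      simp
    · rw [if_neg (by omega : 2 * p ^ 2 ≠ 2), if_neg (by omega : 2 * p ^ 2 ≠ 2 * p), if_pos rfl, Nat.totient_mul h2p2,
        Nat.totient_two, Nat.totient_prime_pow hp.out two_pos]
      simp
  have hsum : ∑ H ∈ A, H.index.totient = B₂.card + (p - 1) * B'.card + p * (p - 1) * B''.card := by
    rw [Finset.sum_congr rfl hpt, Finset.sum_add_distrib, Finset.sum_add_distrib, ← Finset.mul_sum, ← Finset.mul_sum,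
      ← Finset.card_filter, ← Finset.card_filter, ← Finset.card_filter, hA₂, hA', hA'']
  have e : typeRank G (T : Set G) + B₂.card + (p - 1) * B'.card + p * (p - 1) * B''.card =
      typeRank G (T : Set G) + ∑ H ∈ A, H.index.totient := by
    rw [hsum]; ring
  rw [e]
  exact key

/-- **NONDEGENERATE iff `B₂ = B_{2p} = B_{2p²} = ∅`** (exponent `2p²`). [cite: Kubota1965, §4 Lemma 2] [cite: Hazama2003CyclicCM, Prop. 4.3]
[cite: Dodson1984, §3.1.1 Theorem] [cite: Dodson1987, Prop. 4.4] -/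
theorem typeRank_eq_iff [hp : Fact p.Prime] (hp2 : p ≠ 2) {ρ : G} {T : Finset G}
    (h : IsCMTypeWith ρ (T : Set G)) (hexp : ∀ g : G, g ^ (2 * p ^ 2) = 1) :
    typeRank G (T : Set G) = Fintype.card G / 2 + 1 ↔
      (∀ H : Subgroup G, ρ ∉ H → H.index = 2 →
          (T.filter fun s => s ∈ H).card ≠ (T.filter fun s => s ∉ H).card) ∧
      (∀ H : Subgroup G, ρ ∉ H → H.index = 2 * p →
          ¬ ∀ x : G, x ^ p ∈ H → ∀ g : G,
            (T.filter fun s => (g * x)⁻¹ * s ∈ H).card = (T.filter fun s => g⁻¹ * s ∈ H).card) ∧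
      (∀ H : Subgroup G, ρ ∉ H → H.index = 2 * p ^ 2 → IsCyclic (G ⧸ H) →
          ¬ ∀ x : G, x ^ p ∈ H → ∀ g : G,
            (T.filter fun s => (g * x)⁻¹ * s ∈ H).card = (T.filter fun s => g⁻¹ * s ∈ H).card) := by
  have hp1 : p - 1 ≠ 0 := by have := hp.out.two_le; omega
  have hpp1 : p * (p - 1) ≠ 0 := mul_ne_zero hp.out.ne_zero hp1
  rw [eq_iff_of_add_eq₂ₚ₂ hp1 hpp1 (typeRank_add_card_kernels_eq hp2 h hexp), Finset.card_eq_zero, Finset.card_eq_zero,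
    Finset.card_eq_zero, Finset.filter_eq_empty_iff, Finset.filter_eq_empty_iff, Finset.filter_eq_empty_iff]
  simp only [Finset.mem_univ, forall_true_left, not_and, ne_eq]

end Group

/-! ## §2 Abelian CM fields with Galois group of exponent `2p²`: the defect is `b + (p − 1)·e_{2p} + p(p − 1)·e_{2p²}` -/

section Field

variable {K : Type} [Field K] [NumberField K] [IsCMField K] [IsAbelianGalois ℚ K] {p : ℕ}

/-- **The defect on `Gal(K/ℚ)` for an abelian CM field of exponent `2p²`**: `Rank(Φ) + #B₂ + (p − 1)·#B_{2p} + p(p − 1)·#B_{2p²}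
= [K:ℚ]/2 + 1` with the three families of `typeRank_add_card_kernels_eq` read on the subgroups of `Gal(K/ℚ)`.
[cite: Kubota1965, §4 Lemma 2] [cite: Hazama2003CyclicCM, Prop. 4.3] [cite: Dodson1984, §3.1.1 Theorem] [cite: Dodson1987, Prop. 4.4] -/
theorem cmTypeRank_add_card_kernels_eq [Fact p.Prime] (hp2 : p ≠ 2) (φ₀ : K →+* ℂ)
    (hexp : ∀ g : K ≃ₐ[ℚ] K, g ^ (2 * p ^ 2) = 1) (Φ : CMType K) :
    cmTypeRank Φ +
      ((Finset.univ : Finset (Subgroup (K ≃ₐ[ℚ] K))).filter fun H =>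
        (conjGal : K ≃ₐ[ℚ] K) ∉ H ∧ H.index = 2 ∧
        ((Finset.univ.filter fun g : K ≃ₐ[ℚ] K => embOf φ₀ g ∈ Φ.1).filter fun s => s ∈ H).card =
          ((Finset.univ.filter fun g : K ≃ₐ[ℚ] K => embOf φ₀ g ∈ Φ.1).filter fun s => s ∉ H).card).card +
      (p - 1) * ((Finset.univ : Finset (Subgroup (K ≃ₐ[ℚ] K))).filter fun H =>
        (conjGal : K ≃ₐ[ℚ] K) ∉ H ∧ H.index = 2 * p ∧
        ∀ x : K ≃ₐ[ℚ] K, x ^ p ∈ H → ∀ g : K ≃ₐ[ℚ] K,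
          ((Finset.univ.filter fun g : K ≃ₐ[ℚ] K => embOf φ₀ g ∈ Φ.1).filter fun s => (g * x)⁻¹ * s ∈ H).card =
          ((Finset.univ.filter fun g : K ≃ₐ[ℚ] K => embOf φ₀ g ∈ Φ.1).filter fun s => g⁻¹ * s ∈ H).card).card +
      p * (p - 1) * ((Finset.univ : Finset (Subgroup (K ≃ₐ[ℚ] K))).filter fun H =>
        (conjGal : K ≃ₐ[ℚ] K) ∉ H ∧ H.index = 2 * p ^ 2 ∧ IsCyclic ((K ≃ₐ[ℚ] K) ⧸ H) ∧
        ∀ x : K ≃ₐ[ℚ] K, x ^ p ∈ H → ∀ g : K ≃ₐ[ℚ] K,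
          ((Finset.univ.filter fun g : K ≃ₐ[ℚ] K => embOf φ₀ g ∈ Φ.1).filter fun s => (g * x)⁻¹ * s ∈ H).card =
          ((Finset.univ.filter fun g : K ≃ₐ[ℚ] K => embOf φ₀ g ∈ Φ.1).filter fun s => g⁻¹ * s ∈ H).card).card =
      Module.finrank ℚ K / 2 + 1 := by
  rw [cmTypeRank_eq_typeRank_galType Φ φ₀, ← card_gal_eq_finrank φ₀]
  exact typeRank_add_card_kernels_eq hp2 (isCMTypeWith_galType (AbelianCMFieldExistence.apply_conjGal_eq φ₀) Φ) hexp

/-- **THE RANK OF A CM TYPE OF AN ABELIAN CM FIELD OF EXPONENT `2p²`, ON THE LATTICE OF SUBFIELDS.**  Let `K` be a CM field, abelian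
over `ℚ`, whose Galois group satisfies `g^{2p²} = 1` for all `g` (`Gal(K/ℚ) ≅ (ℤ/2)^r × (ℤ/p)^s × (ℤ/p²)^t`, `p` an odd prime — e.g.
`ℚ(ζ₅₇), ℚ(ζ₇₆), ℚ(ζ₁₀₈)` (`ℤ/2 × ℤ/18`), `ℚ(ζ₁₉), ℚ(ζ₂₇)` (`ℤ/18`), their CM subfields and composita with imaginary quadratic fields), and
`Φ` ANY CM type of `K`.  Then

  `Rank(Φ) + b(Φ) + (p − 1)·e_{2p}(Φ) + p(p − 1)·e_{2p²}(Φ) = [K:ℚ]/2 + 1`,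

`b(Φ)` = the number of imaginary quadratic subfields over which `Φ` is balanced (Weil type), `e_{2p}(Φ)` = the number of CM subfields of
degree `2p` (all cyclic) over which `Φ` is LEVEL of exponent `p` (for every `σ ∈ Gal(F/ℚ)` with `σ^p = 1` and every `τ : F → ℂ`,
`#{φ ∈ Φ : φ|_F = τ ∘ σ} = #{φ ∈ Φ : φ|_F = τ}`), `e_{2p²}(Φ)` = the number of CM subfields of degree `2p²` with CYCLIC `Gal(F/ℚ)`
over which `Φ` is level of exponent `p` (multiplicities constant along the orbits of the subgroup of order `p` of `Gal(F/ℚ) ≅ ℤ/2p²` —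
Hazama's LEVEL criterion on `ℤ/2p^k`).  Kubota's defect of `Φ` is `b + (p − 1)e_{2p} + p(p − 1)e_{2p²}`. [cite: Kubota1965, §4 Lemma 2]
[cite: Hazama2003CyclicCM, Prop. 4.3 and Lemma 4.6.1] [cite: Dodson1984, §3.1.1 Theorem] [cite: Dodson1987, Prop. 4.4]
[cite: Yanai2015IndexDegeneracy, Thm. 4.1 (proof, p. 818)] -/
theorem cmTypeRank_add_ncard_subfields_eq [Fact p.Prime] (hp2 : p ≠ 2)
    (hexp : ∀ g : K ≃ₐ[ℚ] K, g ^ (2 * p ^ 2) = 1) (Φ : CMType K) :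
    cmTypeRank Φ + {F : IntermediateField ℚ K | Module.finrank ℚ F = 2 ∧ ¬ IsTotallyReal F ∧
        ∀ τ : F →+* ℂ, {φ : K →+* ℂ | φ.comp (algebraMap F K) = τ ∧ φ ∈ Φ.1}.ncard =
          {φ : K →+* ℂ | φ.comp (algebraMap F K) = τ ∧ φ ∉ Φ.1}.ncard}.ncard +
      (p - 1) * {F : IntermediateField ℚ K | Module.finrank ℚ F = 2 * p ∧ ¬ IsTotallyReal F ∧
        ∀ σ : F ≃ₐ[ℚ] F, σ ^ p = 1 → ∀ τ : F →+* ℂ,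
          {φ : K →+* ℂ | φ.comp (algebraMap F K) = τ.comp σ.toRingEquiv.toRingHom ∧ φ ∈ Φ.1}.ncard =
            {φ : K →+* ℂ | φ.comp (algebraMap F K) = τ ∧ φ ∈ Φ.1}.ncard}.ncard +
      p * (p - 1) * {F : IntermediateField ℚ K | Module.finrank ℚ F = 2 * p ^ 2 ∧ ¬ IsTotallyReal F ∧ IsCyclic (F ≃ₐ[ℚ] F) ∧
        ∀ σ : F ≃ₐ[ℚ] F, σ ^ p = 1 → ∀ τ : F →+* ℂ,
          {φ : K →+* ℂ | φ.comp (algebraMap F K) = τ.comp σ.toRingEquiv.toRingHom ∧ φ ∈ Φ.1}.ncard =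
            {φ : K →+* ℂ | φ.comp (algebraMap F K) = τ ∧ φ ∈ Φ.1}.ncard}.ncard = Module.finrank ℚ K / 2 + 1 := by
  obtain ⟨φ₀⟩ := (inferInstance : Nonempty (K →+* ℂ))
  rw [← card_indexTwo_eq_ncard_weilQuadratic φ₀ Φ, ← card_index_eq_ncard_level φ₀ Φ,
    ← card_index_isCyclic_eq_ncard_level φ₀ Φ (2 * p ^ 2)]
  exact cmTypeRank_add_card_kernels_eq hp2 φ₀ hexp Φ

omit [IsCMField K] [IsAbelianGalois ℚ K] in
/-- A number field has finitely many subfields (primitive element theorem). [folklore] -/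
private theorem finite_intermediateField₂ₚ₂ : Finite (IntermediateField ℚ K) :=
  Field.finite_intermediateField_of_exists_primitive_element ℚ K (Field.exists_primitive_element ℚ K)

/-- **NONDEGENERACY CRITERION ON THE LATTICE OF SUBFIELDS (exponent `2p²`).**  A CM type `Φ` of an abelian CM field `K` with
`g^{2p²} = 1` on `Gal(K/ℚ)` is NONDEGENERATE iff (i) `Φ` is balanced over NO imaginary quadratic subfield, (ii) `Φ` is level of exponent `p`
over NO CM subfield of degree `2p`, and (iii) over NO CM subfield of degree `2p²` with cyclic Galois group.
[cite: Kubota1965, §4 Lemma 2] [cite: Hazama2003CyclicCM, Prop. 4.3] [cite: Dodson1984, §3.1.1 Theorem] [cite: Dodson1987, Prop. 4.4] -/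
theorem isNondegenerate_iff_forall_intermediateField [hp : Fact p.Prime] (hp2 : p ≠ 2)
    (hexp : ∀ g : K ≃ₐ[ℚ] K, g ^ (2 * p ^ 2) = 1) (Φ : CMType K) :
    IsNondegenerate Φ ↔
      (∀ F : IntermediateField ℚ K, Module.finrank ℚ F = 2 → ¬ IsTotallyReal F →
        ¬ ∀ τ : F →+* ℂ, {φ : K →+* ℂ | φ.comp (algebraMap F K) = τ ∧ φ ∈ Φ.1}.ncard =
          {φ : K →+* ℂ | φ.comp (algebraMap F K) = τ ∧ φ ∉ Φ.1}.ncard) ∧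
      (∀ F : IntermediateField ℚ K, Module.finrank ℚ F = 2 * p → ¬ IsTotallyReal F →
        ¬ ∀ σ : F ≃ₐ[ℚ] F, σ ^ p = 1 → ∀ τ : F →+* ℂ,
          {φ : K →+* ℂ | φ.comp (algebraMap F K) = τ.comp σ.toRingEquiv.toRingHom ∧ φ ∈ Φ.1}.ncard =
            {φ : K →+* ℂ | φ.comp (algebraMap F K) = τ ∧ φ ∈ Φ.1}.ncard) ∧
      (∀ F : IntermediateField ℚ K, Module.finrank ℚ F = 2 * p ^ 2 → ¬ IsTotallyReal F → IsCyclic (F ≃ₐ[ℚ] F) →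
        ¬ ∀ σ : F ≃ₐ[ℚ] F, σ ^ p = 1 → ∀ τ : F →+* ℂ,
          {φ : K →+* ℂ | φ.comp (algebraMap F K) = τ.comp σ.toRingEquiv.toRingHom ∧ φ ∈ Φ.1}.ncard =
            {φ : K →+* ℂ | φ.comp (algebraMap F K) = τ ∧ φ ∈ Φ.1}.ncard) := by
  haveI := finite_intermediateField₂ₚ₂ (K := K)
  have hp1 : p - 1 ≠ 0 := by have := hp.out.two_le; omega
  have hpp1 : p * (p - 1) ≠ 0 := mul_ne_zero hp.out.ne_zero hp1
  rw [_root_.Literature.AlgebraicGeometry.Pohlmann1968.isNondegenerate_iff,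
    eq_iff_of_add_eq₂ₚ₂ hp1 hpp1 (cmTypeRank_add_ncard_subfields_eq hp2 hexp Φ),
    Set.ncard_eq_zero, Set.ncard_eq_zero, Set.ncard_eq_zero, Set.eq_empty_iff_forall_notMem,
    Set.eq_empty_iff_forall_notMem, Set.eq_empty_iff_forall_notMem]
  simp only [Set.mem_setOf_eq, not_and]

/-- **Conversely: a CM subfield of degree `2p²` with cyclic Galois group over which `Φ` is level makes the type DEGENERATE** (it costs
`φ(2p²) = p(p − 1)` in rank). [cite: Kubota1965, §4 Lemma 2] [cite: Hazama2003CyclicCM, Prop. 4.3 and Lemma 4.6.1] -/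
theorem not_isNondegenerate_of_level_of_isCyclic [Fact p.Prime] (hp2 : p ≠ 2)
    (hexp : ∀ g : K ≃ₐ[ℚ] K, g ^ (2 * p ^ 2) = 1) (Φ : CMType K) (F : IntermediateField ℚ K)
    (h2p2 : Module.finrank ℚ F = 2 * p ^ 2) (hF : ¬ IsTotallyReal F) (hcyc : IsCyclic (F ≃ₐ[ℚ] F))
    (hlev : ∀ σ : F ≃ₐ[ℚ] F, σ ^ p = 1 → ∀ τ : F →+* ℂ,
      {φ : K →+* ℂ | φ.comp (algebraMap F K) = τ.comp σ.toRingEquiv.toRingHom ∧ φ ∈ Φ.1}.ncard =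
        {φ : K →+* ℂ | φ.comp (algebraMap F K) = τ ∧ φ ∈ Φ.1}.ncard) : ¬ IsNondegenerate Φ := by
  rw [isNondegenerate_iff_forall_intermediateField hp2 hexp Φ]
  exact fun h => h.2.2 F h2p2 hF hcyc hlev

end Field

/-! ## §3 Consequences for abelian varieties: `B•(Aⁿ) ⊗ ℂ = D•(Aⁿ) ⊗ ℂ` and the Hodge conjecture for all powers -/

section Varieties

open Literature.AlgebraicGeometry.Motives (AbelianVariety)
open Literature.AlgebraicGeometry.HodgeTheory
open Literature.AlgebraicGeometry.ComplexMultiplication (IsCMTypeRealisation)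
open Literature.AlgebraicGeometry.VanGeemen1994 (hodgeClassSpan)
open Literature.Barriers.HodgeConjecture (divisorClassesSpan)
open _root_.CategoryTheory _root_.CategoryTheory.Limits

variable {K : Type} [Field K] [NumberField K] [IsCMField K] [IsAbelianGalois ℚ K] {p : ℕ}
  {Φ : CMType K} {A : AbelianVariety ℂ} {ι : 𝓞 K →+* End A} {θ : K →+* Module.End ℂ (complexBetti A.X 1)}

/-- `Bᵐ ⊗ ℂ = Dᵐ ⊗ ℂ` for all `m` on an abelian variety gives the Hodge conjecture for it (Lefschetz `(1,1)`, cup products, tree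
theorems). [cite: Gordon1999HodgeAVSurvey, §9.3] -/
private theorem hodgeConjectureFor_of_forall_hodgeClassSpan_eq₂ₚ₂ (B : AbelianVariety ℂ)
    (h : ∀ m : ℕ, hodgeClassSpan B.dim B.X m = divisorClassesSpan B.X B.dim m) : HodgeConjectureFor B.dim B.X :=
  ⟨nonempty_hodgeModel_holds (Motives.AbelianVariety.isSmoothProjective_holds (A := B)),
    fun m _ hc hmm ↦ AbelianVariety.divisorClassesSpan_le_algebraicClasses B
      (fun b hb hb' ↦ lefschetzOneOne_rational_holds (Motives.AbelianVariety.isSmoothProjective_holds (A := B)) b hb hb') m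
      ((h m) ▸ Submodule.subset_span ⟨hc, hmm⟩)⟩

/-- **`B•(Aⁿ) ⊗ ℂ = D•(Aⁿ) ⊗ ℂ` FOR EVERY REALISATION OF A TYPE SATISFYING THE CRITERION** (`K` abelian CM of exponent `2p²`; `Φ` balanced
over no imaginary quadratic subfield, level over no CM subfield of degree `2p` and over no cyclic CM subfield of degree `2p²`).
[cite: Kubota1965, §4 Lemma 2] [cite: Gordon1999HodgeAVSurvey, Thm. 6.4 and §9.3] [cite: Hazama2003CyclicCM, Prop. 4.3] -/
theorem hodgeClassSpan_pow_eq_divisorClassesSpan_of_forall_intermediateField [Fact p.Prime] (hp2 : p ≠ 2)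
    (hexp : ∀ g : K ≃ₐ[ℚ] K, g ^ (2 * p ^ 2) = 1)
    (hW : ∀ F : IntermediateField ℚ K, Module.finrank ℚ F = 2 → ¬ IsTotallyReal F →
        ¬ ∀ τ : F →+* ℂ, {φ : K →+* ℂ | φ.comp (algebraMap F K) = τ ∧ φ ∈ Φ.1}.ncard =
          {φ : K →+* ℂ | φ.comp (algebraMap F K) = τ ∧ φ ∉ Φ.1}.ncard)
    (hL : ∀ F : IntermediateField ℚ K, Module.finrank ℚ F = 2 * p → ¬ IsTotallyReal F →
        ¬ ∀ σ : F ≃ₐ[ℚ] F, σ ^ p = 1 → ∀ τ : F →+* ℂ,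
          {φ : K →+* ℂ | φ.comp (algebraMap F K) = τ.comp σ.toRingEquiv.toRingHom ∧ φ ∈ Φ.1}.ncard =
            {φ : K →+* ℂ | φ.comp (algebraMap F K) = τ ∧ φ ∈ Φ.1}.ncard)
    (hM : ∀ F : IntermediateField ℚ K, Module.finrank ℚ F = 2 * p ^ 2 → ¬ IsTotallyReal F → IsCyclic (F ≃ₐ[ℚ] F) →
        ¬ ∀ σ : F ≃ₐ[ℚ] F, σ ^ p = 1 → ∀ τ : F →+* ℂ,
          {φ : K →+* ℂ | φ.comp (algebraMap F K) = τ.comp σ.toRingEquiv.toRingHom ∧ φ ∈ Φ.1}.ncard =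
            {φ : K →+* ℂ | φ.comp (algebraMap F K) = τ ∧ φ ∈ Φ.1}.ncard)
    (hA : IsCMTypeRealisation Φ A ι θ) (n m : ℕ) :
    hodgeClassSpan (⨁ fun _ : Fin n => A).dim (⨁ fun _ : Fin n => A).X m =
      divisorClassesSpan (⨁ fun _ : Fin n => A).X (⨁ fun _ : Fin n => A).dim m :=
  ((isNondegenerate_iff_forall_intermediateField hp2 hexp Φ).2 ⟨hW, hL, hM⟩).hodgeClassSpan_pow_eq_divisorClassesSpan hA n m

/-- **THE HODGE CONJECTURE FOR ALL POWERS OF EVERY REALISATION OF A TYPE SATISFYING THE CRITERION** (abelian CM field of exponent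
`2p²`) — UNCONDITIONAL, any realisation. [cite: Gordon1999HodgeAVSurvey, Thm. 6.4 and §9.3] [cite: Kubota1965, §4 Lemma 2] [cite: Deligne2000, §1] -/
theorem hodgeConjectureFor_pow_of_forall_intermediateField [Fact p.Prime] (hp2 : p ≠ 2)
    (hexp : ∀ g : K ≃ₐ[ℚ] K, g ^ (2 * p ^ 2) = 1)
    (hW : ∀ F : IntermediateField ℚ K, Module.finrank ℚ F = 2 → ¬ IsTotallyReal F →
        ¬ ∀ τ : F →+* ℂ, {φ : K →+* ℂ | φ.comp (algebraMap F K) = τ ∧ φ ∈ Φ.1}.ncard =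
          {φ : K →+* ℂ | φ.comp (algebraMap F K) = τ ∧ φ ∉ Φ.1}.ncard)
    (hL : ∀ F : IntermediateField ℚ K, Module.finrank ℚ F = 2 * p → ¬ IsTotallyReal F →
        ¬ ∀ σ : F ≃ₐ[ℚ] F, σ ^ p = 1 → ∀ τ : F →+* ℂ,
          {φ : K →+* ℂ | φ.comp (algebraMap F K) = τ.comp σ.toRingEquiv.toRingHom ∧ φ ∈ Φ.1}.ncard =
            {φ : K →+* ℂ | φ.comp (algebraMap F K) = τ ∧ φ ∈ Φ.1}.ncard)
    (hM : ∀ F : IntermediateField ℚ K, Module.finrank ℚ F = 2 * p ^ 2 → ¬ IsTotallyReal F → IsCyclic (F ≃ₐ[ℚ] F) →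
        ¬ ∀ σ : F ≃ₐ[ℚ] F, σ ^ p = 1 → ∀ τ : F →+* ℂ,
          {φ : K →+* ℂ | φ.comp (algebraMap F K) = τ.comp σ.toRingEquiv.toRingHom ∧ φ ∈ Φ.1}.ncard =
            {φ : K →+* ℂ | φ.comp (algebraMap F K) = τ ∧ φ ∈ Φ.1}.ncard)
    (hA : IsCMTypeRealisation Φ A ι θ) (n : ℕ) :
    HodgeConjectureFor (⨁ fun _ : Fin n => A).dim (⨁ fun _ : Fin n => A).X :=
  hodgeConjectureFor_of_forall_hodgeClassSpan_eq₂ₚ₂ _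
    fun m ↦ hodgeClassSpan_pow_eq_divisorClassesSpan_of_forall_intermediateField hp2 hexp hW hL hM hA n m

/-- **No power of such an `A` carries an exceptional Hodge class.** [cite: Gordon1999HodgeAVSurvey, Thm. 6.4] -/
theorem not_exists_exceptional_pow_of_forall_intermediateField [Fact p.Prime] (hp2 : p ≠ 2)
    (hexp : ∀ g : K ≃ₐ[ℚ] K, g ^ (2 * p ^ 2) = 1)
    (hW : ∀ F : IntermediateField ℚ K, Module.finrank ℚ F = 2 → ¬ IsTotallyReal F →
        ¬ ∀ τ : F →+* ℂ, {φ : K →+* ℂ | φ.comp (algebraMap F K) = τ ∧ φ ∈ Φ.1}.ncard =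
          {φ : K →+* ℂ | φ.comp (algebraMap F K) = τ ∧ φ ∉ Φ.1}.ncard)
    (hL : ∀ F : IntermediateField ℚ K, Module.finrank ℚ F = 2 * p → ¬ IsTotallyReal F →
        ¬ ∀ σ : F ≃ₐ[ℚ] F, σ ^ p = 1 → ∀ τ : F →+* ℂ,
          {φ : K →+* ℂ | φ.comp (algebraMap F K) = τ.comp σ.toRingEquiv.toRingHom ∧ φ ∈ Φ.1}.ncard =
            {φ : K →+* ℂ | φ.comp (algebraMap F K) = τ ∧ φ ∈ Φ.1}.ncard)
    (hM : ∀ F : IntermediateField ℚ K, Module.finrank ℚ F = 2 * p ^ 2 → ¬ IsTotallyReal F → IsCyclic (F ≃ₐ[ℚ] F) →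
        ¬ ∀ σ : F ≃ₐ[ℚ] F, σ ^ p = 1 → ∀ τ : F →+* ℂ,
          {φ : K →+* ℂ | φ.comp (algebraMap F K) = τ.comp σ.toRingEquiv.toRingHom ∧ φ ∈ Φ.1}.ncard =
            {φ : K →+* ℂ | φ.comp (algebraMap F K) = τ ∧ φ ∈ Φ.1}.ncard)
    (hA : IsCMTypeRealisation Φ A ι θ) (n m : ℕ) :
    ¬ ∃ c : complexBetti (⨁ fun _ : Fin n => A).X (2 * m), IsRationalClass c ∧
        IsOfHodgeType (⨁ fun _ : Fin n => A).dim (⨁ fun _ : Fin n => A).X (2 * m) m m c ∧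
        c ∉ divisorClassesSpan (⨁ fun _ : Fin n => A).X (⨁ fun _ : Fin n => A).dim m := by
  rintro ⟨c, hcQ, hcH, hcD⟩
  exact hcD ((hodgeClassSpan_pow_eq_divisorClassesSpan_of_forall_intermediateField hp2 hexp hW hL hM hA n m) ▸
    Submodule.subset_span ⟨hcQ, hcH⟩)

end Varieties

/-! ## §4 The cyclotomic fields `ℚ(ζ_q)` with `(ℤ/q)ˣ` of exponent `2p²`: `q = 57, 76, 108` (`ℤ/2 × ℤ/18`, `φ = 36`) -/

section Cyclotomic

open Literature.AlgebraicGeometry.Motives (AbelianVariety)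
open Literature.AlgebraicGeometry.HodgeTheory
open Literature.AlgebraicGeometry.ComplexMultiplication (IsCMTypeRealisation)
open Literature.AlgebraicGeometry.VanGeemen1994 (hodgeClassSpan)
open Literature.Barriers.HodgeConjecture (divisorClassesSpan)
open _root_.CategoryTheory _root_.CategoryTheory.Limits
open Polynomial

variable {q p : ℕ} {L : Type} [Field L] [NumberField L]
  {Φ : CMType L} {A : AbelianVariety ℂ} {ι : 𝓞 L →+* End A} {θ : L →+* Module.End ℂ (complexBetti A.X 1)}

/-- **The rank formula for `ℚ(ζ_q)`, `(ℤ/q)ˣ` of exponent `2p²`**: `Rank(Φ) + b(Φ) + (p − 1)·e_{2p}(Φ) + p(p − 1)·e_{2p²}(Φ) = φ(q)/2 + 1`.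
[cite: Kubota1965, §4 Lemma 2] [cite: Hazama2003CyclicCM, Prop. 4.3] [cite: Dodson1984, §3.1.1 Theorem] [cite: Dodson1987, Prop. 4.4] -/
theorem cmTypeRank_add_ncard_subfields_eq_of_isCyclotomicExtension [NeZero q] [IsCyclotomicExtension {q} ℚ L]
    (h2q : 2 < q) [Fact p.Prime] (hp2 : p ≠ 2) (hq : ∀ u : (ZMod q)ˣ, u ^ (2 * p ^ 2) = 1) (Φ : CMType L) :
    cmTypeRank Φ + {F : IntermediateField ℚ L | Module.finrank ℚ F = 2 ∧ ¬ IsTotallyReal F ∧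
        ∀ τ : F →+* ℂ, {φ : L →+* ℂ | φ.comp (algebraMap F L) = τ ∧ φ ∈ Φ.1}.ncard =
          {φ : L →+* ℂ | φ.comp (algebraMap F L) = τ ∧ φ ∉ Φ.1}.ncard}.ncard +
      (p - 1) * {F : IntermediateField ℚ L | Module.finrank ℚ F = 2 * p ∧ ¬ IsTotallyReal F ∧
        ∀ σ : F ≃ₐ[ℚ] F, σ ^ p = 1 → ∀ τ : F →+* ℂ,
          {φ : L →+* ℂ | φ.comp (algebraMap F L) = τ.comp σ.toRingEquiv.toRingHom ∧ φ ∈ Φ.1}.ncard =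
            {φ : L →+* ℂ | φ.comp (algebraMap F L) = τ ∧ φ ∈ Φ.1}.ncard}.ncard +
      p * (p - 1) * {F : IntermediateField ℚ L | Module.finrank ℚ F = 2 * p ^ 2 ∧ ¬ IsTotallyReal F ∧ IsCyclic (F ≃ₐ[ℚ] F) ∧
        ∀ σ : F ≃ₐ[ℚ] F, σ ^ p = 1 → ∀ τ : F →+* ℂ,
          {φ : L →+* ℂ | φ.comp (algebraMap F L) = τ.comp σ.toRingEquiv.toRingHom ∧ φ ∈ Φ.1}.ncard =
            {φ : L →+* ℂ | φ.comp (algebraMap F L) = τ ∧ φ ∈ Φ.1}.ncard}.ncard = Nat.totient q / 2 + 1 := by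
  obtain ⟨hcm, hab, hexp, hL⟩ := cm_abelian_pow_eq_one_of_isCyclotomicExtension h2q hq L
  haveI := hcm; haveI := hab
  rw [← hL]
  exact cmTypeRank_add_ncard_subfields_eq hp2 hexp Φ

/-- **Nondegeneracy criterion for `ℚ(ζ_q)`, `(ℤ/q)ˣ` of exponent `2p²`.** [cite: Kubota1965, §4 Lemma 2] [cite: Hazama2003CyclicCM, Prop. 4.3]
[cite: Dodson1984, §3.1.1 Theorem] [cite: Dodson1987, Prop. 4.4] -/
theorem isNondegenerate_iff_of_isCyclotomicExtension [NeZero q] [IsCyclotomicExtension {q} ℚ L]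
    (h2q : 2 < q) [Fact p.Prime] (hp2 : p ≠ 2) (hq : ∀ u : (ZMod q)ˣ, u ^ (2 * p ^ 2) = 1) (Φ : CMType L) :
    IsNondegenerate Φ ↔
      (∀ F : IntermediateField ℚ L, Module.finrank ℚ F = 2 → ¬ IsTotallyReal F →
        ¬ ∀ τ : F →+* ℂ, {φ : L →+* ℂ | φ.comp (algebraMap F L) = τ ∧ φ ∈ Φ.1}.ncard =
          {φ : L →+* ℂ | φ.comp (algebraMap F L) = τ ∧ φ ∉ Φ.1}.ncard) ∧
      (∀ F : IntermediateField ℚ L, Module.finrank ℚ F = 2 * p → ¬ IsTotallyReal F →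
        ¬ ∀ σ : F ≃ₐ[ℚ] F, σ ^ p = 1 → ∀ τ : F →+* ℂ,
          {φ : L →+* ℂ | φ.comp (algebraMap F L) = τ.comp σ.toRingEquiv.toRingHom ∧ φ ∈ Φ.1}.ncard =
            {φ : L →+* ℂ | φ.comp (algebraMap F L) = τ ∧ φ ∈ Φ.1}.ncard) ∧
      (∀ F : IntermediateField ℚ L, Module.finrank ℚ F = 2 * p ^ 2 → ¬ IsTotallyReal F → IsCyclic (F ≃ₐ[ℚ] F) →
        ¬ ∀ σ : F ≃ₐ[ℚ] F, σ ^ p = 1 → ∀ τ : F →+* ℂ,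
          {φ : L →+* ℂ | φ.comp (algebraMap F L) = τ.comp σ.toRingEquiv.toRingHom ∧ φ ∈ Φ.1}.ncard =
            {φ : L →+* ℂ | φ.comp (algebraMap F L) = τ ∧ φ ∈ Φ.1}.ncard) := by
  obtain ⟨hcm, hab, hexp, -⟩ := cm_abelian_pow_eq_one_of_isCyclotomicExtension h2q hq L
  haveI := hcm; haveI := hab
  exact isNondegenerate_iff_forall_intermediateField hp2 hexp Φ

/-- **The Hodge conjecture for all powers of every realisation of a type of `ℚ(ζ_q)`** (`(ℤ/q)ˣ` of exponent `2p²`) **satisfying the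
three-clause criterion** — UNCONDITIONAL. [cite: Gordon1999HodgeAVSurvey, Thm. 6.4 and §9.3] [cite: Kubota1965, §4 Lemma 2] -/
theorem hodgeConjectureFor_pow_of_forall_of_isCyclotomicExtension [NeZero q] [IsCyclotomicExtension {q} ℚ L]
    (h2q : 2 < q) [Fact p.Prime] (hp2 : p ≠ 2) (hq : ∀ u : (ZMod q)ˣ, u ^ (2 * p ^ 2) = 1)
    (hW : ∀ F : IntermediateField ℚ L, Module.finrank ℚ F = 2 → ¬ IsTotallyReal F →
        ¬ ∀ τ : F →+* ℂ, {φ : L →+* ℂ | φ.comp (algebraMap F L) = τ ∧ φ ∈ Φ.1}.ncard =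
          {φ : L →+* ℂ | φ.comp (algebraMap F L) = τ ∧ φ ∉ Φ.1}.ncard)
    (hL : ∀ F : IntermediateField ℚ L, Module.finrank ℚ F = 2 * p → ¬ IsTotallyReal F →
        ¬ ∀ σ : F ≃ₐ[ℚ] F, σ ^ p = 1 → ∀ τ : F →+* ℂ,
          {φ : L →+* ℂ | φ.comp (algebraMap F L) = τ.comp σ.toRingEquiv.toRingHom ∧ φ ∈ Φ.1}.ncard =
            {φ : L →+* ℂ | φ.comp (algebraMap F L) = τ ∧ φ ∈ Φ.1}.ncard)
    (hM : ∀ F : IntermediateField ℚ L, Module.finrank ℚ F = 2 * p ^ 2 → ¬ IsTotallyReal F → IsCyclic (F ≃ₐ[ℚ] F) →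
        ¬ ∀ σ : F ≃ₐ[ℚ] F, σ ^ p = 1 → ∀ τ : F →+* ℂ,
          {φ : L →+* ℂ | φ.comp (algebraMap F L) = τ.comp σ.toRingEquiv.toRingHom ∧ φ ∈ Φ.1}.ncard =
            {φ : L →+* ℂ | φ.comp (algebraMap F L) = τ ∧ φ ∈ Φ.1}.ncard)
    (hA : IsCMTypeRealisation Φ A ι θ) (n : ℕ) :
    HodgeConjectureFor (⨁ fun _ : Fin n => A).dim (⨁ fun _ : Fin n => A).X := by
  obtain ⟨hcm, hab, hexp, -⟩ := cm_abelian_pow_eq_one_of_isCyclotomicExtension h2q hq L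
  haveI := hcm; haveI := hab
  exact hodgeConjectureFor_pow_of_forall_intermediateField hp2 hexp hW hL hM hA n

/-! ### The levels `57, 76, 108`: `(ℤ/q)ˣ ≅ ℤ/2 × ℤ/18`, `φ(q) = 36`, `p = 3` -/

/-- `u¹⁸ = 1` for every unit of `ℤ/57`: `(ℤ/57)ˣ ≅ ℤ/2 × ℤ/18` (kernel decision on the residues coprime to `57`).
[cite: Washington1997, Ch. 2 Thm. 2.5] -/
theorem units_pow_eighteen_fiftySeven (u : (ZMod 57)ˣ) : u ^ (2 * 3 ^ 2) = 1 := by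
  have h : ∀ a : ZMod 57, Nat.Coprime a.val 57 → a ^ 18 = 1 := by decide +kernel
  rw [show (2 * 3 ^ 2 : ℕ) = 18 by norm_num]
  exact Units.ext (by rw [Units.val_pow_eq_pow_val, h _ (ZMod.val_coe_unit_coprime u), Units.val_one])

/-- **`ℚ(ζ₅₇)` (degree `36`, `Gal ≅ ℤ/2 × ℤ/18`): `Rank(Φ) + b(Φ) + 2·e₆(Φ) + 6·e₁₈(Φ) = 19`** for EVERY CM type `Φ` — `b` = the number of
imaginary quadratic subfields over which `Φ` is of Weil type, `e₆` = the number of (cyclic) sextic CM subfields over which `Φ` is level of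
exponent `3`, `e₁₈` = the number of CM subfields of degree `18` with cyclic Galois group over which `Φ` is level of exponent `3`.
[cite: Kubota1965, §4 Lemma 2] [cite: Hazama2003CyclicCM, Prop. 4.3] [cite: Dodson1984, §3.1.1 Theorem] [cite: Dodson1987, Prop. 4.4] -/
theorem cmTypeRank_add_ncard_subfields_fiftySeven [IsCyclotomicExtension {57} ℚ L] (Φ : CMType L) :
    cmTypeRank Φ + {F : IntermediateField ℚ L | Module.finrank ℚ F = 2 ∧ ¬ IsTotallyReal F ∧
        ∀ τ : F →+* ℂ, {φ : L →+* ℂ | φ.comp (algebraMap F L) = τ ∧ φ ∈ Φ.1}.ncard =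
          {φ : L →+* ℂ | φ.comp (algebraMap F L) = τ ∧ φ ∉ Φ.1}.ncard}.ncard +
      2 * {F : IntermediateField ℚ L | Module.finrank ℚ F = 6 ∧ ¬ IsTotallyReal F ∧
        ∀ σ : F ≃ₐ[ℚ] F, σ ^ (3 : ℕ) = AlgEquiv.refl → ∀ τ : F →+* ℂ,
          {φ : L →+* ℂ | φ.comp (algebraMap F L) = τ.comp σ.toRingEquiv.toRingHom ∧ φ ∈ Φ.1}.ncard =
            {φ : L →+* ℂ | φ.comp (algebraMap F L) = τ ∧ φ ∈ Φ.1}.ncard}.ncard +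
      6 * {F : IntermediateField ℚ L | Module.finrank ℚ F = 18 ∧ ¬ IsTotallyReal F ∧ IsCyclic (F ≃ₐ[ℚ] F) ∧
        ∀ σ : F ≃ₐ[ℚ] F, σ ^ (3 : ℕ) = AlgEquiv.refl → ∀ τ : F →+* ℂ,
          {φ : L →+* ℂ | φ.comp (algebraMap F L) = τ.comp σ.toRingEquiv.toRingHom ∧ φ ∈ Φ.1}.ncard =
            {φ : L →+* ℂ | φ.comp (algebraMap F L) = τ ∧ φ ∈ Φ.1}.ncard}.ncard = 19 := by
  haveI : Fact (Nat.Prime 3) := ⟨Nat.prime_three⟩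
  have h := cmTypeRank_add_ncard_subfields_eq_of_isCyclotomicExtension (L := L) (q := 57) (by norm_num)
    (by decide : (3 : ℕ) ≠ 2) units_pow_eighteen_fiftySeven Φ
  have hφ : Nat.totient 57 = 36 := by decide
  rw [hφ] at h
  exact h

/-- **`ℚ(ζ₅₇)`: THE HODGE CONJECTURE FOR ALL POWERS of every abelian variety with complex multiplication by `ℚ(ζ₅₇)` (CM `18`-folds) whose
type is of Weil type over no imaginary quadratic subfield and level of exponent `3` over no sextic CM subfield and over no cyclic CM
subfield of degree `18`** — UNCONDITIONAL. [cite: Gordon1999HodgeAVSurvey, Thm. 6.4 and §9.3] [cite: Kubota1965, §4 Lemma 2] -/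
theorem hodgeConjectureFor_pow_of_forall_fiftySeven [IsCyclotomicExtension {57} ℚ L]
    (hW : ∀ F : IntermediateField ℚ L, Module.finrank ℚ F = 2 → ¬ IsTotallyReal F →
        ¬ ∀ τ : F →+* ℂ, {φ : L →+* ℂ | φ.comp (algebraMap F L) = τ ∧ φ ∈ Φ.1}.ncard =
          {φ : L →+* ℂ | φ.comp (algebraMap F L) = τ ∧ φ ∉ Φ.1}.ncard)
    (hL : ∀ F : IntermediateField ℚ L, Module.finrank ℚ F = 2 * 3 → ¬ IsTotallyReal F →
        ¬ ∀ σ : F ≃ₐ[ℚ] F, σ ^ (3 : ℕ) = AlgEquiv.refl → ∀ τ : F →+* ℂ,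
          {φ : L →+* ℂ | φ.comp (algebraMap F L) = τ.comp σ.toRingEquiv.toRingHom ∧ φ ∈ Φ.1}.ncard =
            {φ : L →+* ℂ | φ.comp (algebraMap F L) = τ ∧ φ ∈ Φ.1}.ncard)
    (hM : ∀ F : IntermediateField ℚ L, Module.finrank ℚ F = 2 * 3 ^ 2 → ¬ IsTotallyReal F → IsCyclic (F ≃ₐ[ℚ] F) →
        ¬ ∀ σ : F ≃ₐ[ℚ] F, σ ^ (3 : ℕ) = AlgEquiv.refl → ∀ τ : F →+* ℂ,
          {φ : L →+* ℂ | φ.comp (algebraMap F L) = τ.comp σ.toRingEquiv.toRingHom ∧ φ ∈ Φ.1}.ncard =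
            {φ : L →+* ℂ | φ.comp (algebraMap F L) = τ ∧ φ ∈ Φ.1}.ncard)
    (hA : IsCMTypeRealisation Φ A ι θ) (n : ℕ) :
    HodgeConjectureFor (⨁ fun _ : Fin n => A).dim (⨁ fun _ : Fin n => A).X :=
  haveI : Fact (Nat.Prime 3) := ⟨Nat.prime_three⟩
  hodgeConjectureFor_pow_of_forall_of_isCyclotomicExtension (q := 57) (by norm_num) (by decide) units_pow_eighteen_fiftySeven
    hW hL hM hA n

/-- `u¹⁸ = 1` for every unit of `ℤ/76`: `(ℤ/76)ˣ ≅ ℤ/2 × ℤ/18` (kernel decision on the residues coprime to `76`).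
[cite: Washington1997, Ch. 2 Thm. 2.5] -/
theorem units_pow_eighteen_seventySix (u : (ZMod 76)ˣ) : u ^ (2 * 3 ^ 2) = 1 := by
  have h : ∀ a : ZMod 76, Nat.Coprime a.val 76 → a ^ 18 = 1 := by decide +kernel
  rw [show (2 * 3 ^ 2 : ℕ) = 18 by norm_num]
  exact Units.ext (by rw [Units.val_pow_eq_pow_val, h _ (ZMod.val_coe_unit_coprime u), Units.val_one])

/-- **`ℚ(ζ₇₆)` (degree `36`, `Gal ≅ ℤ/2 × ℤ/18`): `Rank(Φ) + b(Φ) + 2·e₆(Φ) + 6·e₁₈(Φ) = 19`** for EVERY CM type `Φ` — `b` = the number of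
imaginary quadratic subfields over which `Φ` is of Weil type, `e₆` = the number of (cyclic) sextic CM subfields over which `Φ` is level of
exponent `3`, `e₁₈` = the number of CM subfields of degree `18` with cyclic Galois group over which `Φ` is level of exponent `3`.
[cite: Kubota1965, §4 Lemma 2] [cite: Hazama2003CyclicCM, Prop. 4.3] [cite: Dodson1984, §3.1.1 Theorem] [cite: Dodson1987, Prop. 4.4] -/
theorem cmTypeRank_add_ncard_subfields_seventySix [IsCyclotomicExtension {76} ℚ L] (Φ : CMType L) :
    cmTypeRank Φ + {F : IntermediateField ℚ L | Module.finrank ℚ F = 2 ∧ ¬ IsTotallyReal F ∧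
        ∀ τ : F →+* ℂ, {φ : L →+* ℂ | φ.comp (algebraMap F L) = τ ∧ φ ∈ Φ.1}.ncard =
          {φ : L →+* ℂ | φ.comp (algebraMap F L) = τ ∧ φ ∉ Φ.1}.ncard}.ncard +
      2 * {F : IntermediateField ℚ L | Module.finrank ℚ F = 6 ∧ ¬ IsTotallyReal F ∧
        ∀ σ : F ≃ₐ[ℚ] F, σ ^ (3 : ℕ) = AlgEquiv.refl → ∀ τ : F →+* ℂ,
          {φ : L →+* ℂ | φ.comp (algebraMap F L) = τ.comp σ.toRingEquiv.toRingHom ∧ φ ∈ Φ.1}.ncard =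
            {φ : L →+* ℂ | φ.comp (algebraMap F L) = τ ∧ φ ∈ Φ.1}.ncard}.ncard +
      6 * {F : IntermediateField ℚ L | Module.finrank ℚ F = 18 ∧ ¬ IsTotallyReal F ∧ IsCyclic (F ≃ₐ[ℚ] F) ∧
        ∀ σ : F ≃ₐ[ℚ] F, σ ^ (3 : ℕ) = AlgEquiv.refl → ∀ τ : F →+* ℂ,
          {φ : L →+* ℂ | φ.comp (algebraMap F L) = τ.comp σ.toRingEquiv.toRingHom ∧ φ ∈ Φ.1}.ncard =
            {φ : L →+* ℂ | φ.comp (algebraMap F L) = τ ∧ φ ∈ Φ.1}.ncard}.ncard = 19 := by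
  haveI : Fact (Nat.Prime 3) := ⟨Nat.prime_three⟩
  have h := cmTypeRank_add_ncard_subfields_eq_of_isCyclotomicExtension (L := L) (q := 76) (by norm_num)
    (by decide : (3 : ℕ) ≠ 2) units_pow_eighteen_seventySix Φ
  have hφ : Nat.totient 76 = 36 := by decide
  rw [hφ] at h
  exact h

/-- **`ℚ(ζ₇₆)`: THE HODGE CONJECTURE FOR ALL POWERS of every abelian variety with complex multiplication by `ℚ(ζ₇₆)` (CM `18`-folds) whose
type is of Weil type over no imaginary quadratic subfield and level of exponent `3` over no sextic CM subfield and over no cyclic CM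
subfield of degree `18`** — UNCONDITIONAL. [cite: Gordon1999HodgeAVSurvey, Thm. 6.4 and §9.3] [cite: Kubota1965, §4 Lemma 2] -/
theorem hodgeConjectureFor_pow_of_forall_seventySix [IsCyclotomicExtension {76} ℚ L]
    (hW : ∀ F : IntermediateField ℚ L, Module.finrank ℚ F = 2 → ¬ IsTotallyReal F →
        ¬ ∀ τ : F →+* ℂ, {φ : L →+* ℂ | φ.comp (algebraMap F L) = τ ∧ φ ∈ Φ.1}.ncard =
          {φ : L →+* ℂ | φ.comp (algebraMap F L) = τ ∧ φ ∉ Φ.1}.ncard)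
    (hL : ∀ F : IntermediateField ℚ L, Module.finrank ℚ F = 2 * 3 → ¬ IsTotallyReal F →
        ¬ ∀ σ : F ≃ₐ[ℚ] F, σ ^ (3 : ℕ) = AlgEquiv.refl → ∀ τ : F →+* ℂ,
          {φ : L →+* ℂ | φ.comp (algebraMap F L) = τ.comp σ.toRingEquiv.toRingHom ∧ φ ∈ Φ.1}.ncard =
            {φ : L →+* ℂ | φ.comp (algebraMap F L) = τ ∧ φ ∈ Φ.1}.ncard)
    (hM : ∀ F : IntermediateField ℚ L, Module.finrank ℚ F = 2 * 3 ^ 2 → ¬ IsTotallyReal F → IsCyclic (F ≃ₐ[ℚ] F) →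
        ¬ ∀ σ : F ≃ₐ[ℚ] F, σ ^ (3 : ℕ) = AlgEquiv.refl → ∀ τ : F →+* ℂ,
          {φ : L →+* ℂ | φ.comp (algebraMap F L) = τ.comp σ.toRingEquiv.toRingHom ∧ φ ∈ Φ.1}.ncard =
            {φ : L →+* ℂ | φ.comp (algebraMap F L) = τ ∧ φ ∈ Φ.1}.ncard)
    (hA : IsCMTypeRealisation Φ A ι θ) (n : ℕ) :
    HodgeConjectureFor (⨁ fun _ : Fin n => A).dim (⨁ fun _ : Fin n => A).X :=
  haveI : Fact (Nat.Prime 3) := ⟨Nat.prime_three⟩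
  hodgeConjectureFor_pow_of_forall_of_isCyclotomicExtension (q := 76) (by norm_num) (by decide) units_pow_eighteen_seventySix
    hW hL hM hA n

/-- `u¹⁸ = 1` for every unit of `ℤ/108`: `(ℤ/108)ˣ ≅ ℤ/2 × ℤ/18` (kernel decision on the residues coprime to `108`).
[cite: Washington1997, Ch. 2 Thm. 2.5] -/
theorem units_pow_eighteen_oneHundredEight (u : (ZMod 108)ˣ) : u ^ (2 * 3 ^ 2) = 1 := by
  have h : ∀ a : ZMod 108, Nat.Coprime a.val 108 → a ^ 18 = 1 := by decide +kernel
  rw [show (2 * 3 ^ 2 : ℕ) = 18 by norm_num]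
  exact Units.ext (by rw [Units.val_pow_eq_pow_val, h _ (ZMod.val_coe_unit_coprime u), Units.val_one])

/-- **`ℚ(ζ₁₀₈)` (degree `36`, `Gal ≅ ℤ/2 × ℤ/18`): `Rank(Φ) + b(Φ) + 2·e₆(Φ) + 6·e₁₈(Φ) = 19`** for EVERY CM type `Φ` — `b` = the number of
imaginary quadratic subfields over which `Φ` is of Weil type, `e₆` = the number of (cyclic) sextic CM subfields over which `Φ` is level of
exponent `3`, `e₁₈` = the number of CM subfields of degree `18` with cyclic Galois group over which `Φ` is level of exponent `3`.
[cite: Kubota1965, §4 Lemma 2] [cite: Hazama2003CyclicCM, Prop. 4.3] [cite: Dodson1984, §3.1.1 Theorem] [cite: Dodson1987, Prop. 4.4] -/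
theorem cmTypeRank_add_ncard_subfields_oneHundredEight [IsCyclotomicExtension {108} ℚ L] (Φ : CMType L) :
    cmTypeRank Φ + {F : IntermediateField ℚ L | Module.finrank ℚ F = 2 ∧ ¬ IsTotallyReal F ∧
        ∀ τ : F →+* ℂ, {φ : L →+* ℂ | φ.comp (algebraMap F L) = τ ∧ φ ∈ Φ.1}.ncard =
          {φ : L →+* ℂ | φ.comp (algebraMap F L) = τ ∧ φ ∉ Φ.1}.ncard}.ncard +
      2 * {F : IntermediateField ℚ L | Module.finrank ℚ F = 6 ∧ ¬ IsTotallyReal F ∧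
        ∀ σ : F ≃ₐ[ℚ] F, σ ^ (3 : ℕ) = AlgEquiv.refl → ∀ τ : F →+* ℂ,
          {φ : L →+* ℂ | φ.comp (algebraMap F L) = τ.comp σ.toRingEquiv.toRingHom ∧ φ ∈ Φ.1}.ncard =
            {φ : L →+* ℂ | φ.comp (algebraMap F L) = τ ∧ φ ∈ Φ.1}.ncard}.ncard +
      6 * {F : IntermediateField ℚ L | Module.finrank ℚ F = 18 ∧ ¬ IsTotallyReal F ∧ IsCyclic (F ≃ₐ[ℚ] F) ∧
        ∀ σ : F ≃ₐ[ℚ] F, σ ^ (3 : ℕ) = AlgEquiv.refl → ∀ τ : F →+* ℂ,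
          {φ : L →+* ℂ | φ.comp (algebraMap F L) = τ.comp σ.toRingEquiv.toRingHom ∧ φ ∈ Φ.1}.ncard =
            {φ : L →+* ℂ | φ.comp (algebraMap F L) = τ ∧ φ ∈ Φ.1}.ncard}.ncard = 19 := by
  haveI : Fact (Nat.Prime 3) := ⟨Nat.prime_three⟩
  have h := cmTypeRank_add_ncard_subfields_eq_of_isCyclotomicExtension (L := L) (q := 108) (by norm_num)
    (by decide : (3 : ℕ) ≠ 2) units_pow_eighteen_oneHundredEight Φ
  have hφ : Nat.totient 108 = 36 := by decide
  rw [hφ] at h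
  exact h

/-- **`ℚ(ζ₁₀₈)`: THE HODGE CONJECTURE FOR ALL POWERS of every abelian variety with complex multiplication by `ℚ(ζ₁₀₈)` (CM `18`-folds) whose
type is of Weil type over no imaginary quadratic subfield and level of exponent `3` over no sextic CM subfield and over no cyclic CM
subfield of degree `18`** — UNCONDITIONAL. [cite: Gordon1999HodgeAVSurvey, Thm. 6.4 and §9.3] [cite: Kubota1965, §4 Lemma 2] -/
theorem hodgeConjectureFor_pow_of_forall_oneHundredEight [IsCyclotomicExtension {108} ℚ L]
    (hW : ∀ F : IntermediateField ℚ L, Module.finrank ℚ F = 2 → ¬ IsTotallyReal F →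
        ¬ ∀ τ : F →+* ℂ, {φ : L →+* ℂ | φ.comp (algebraMap F L) = τ ∧ φ ∈ Φ.1}.ncard =
          {φ : L →+* ℂ | φ.comp (algebraMap F L) = τ ∧ φ ∉ Φ.1}.ncard)
    (hL : ∀ F : IntermediateField ℚ L, Module.finrank ℚ F = 2 * 3 → ¬ IsTotallyReal F →
        ¬ ∀ σ : F ≃ₐ[ℚ] F, σ ^ (3 : ℕ) = AlgEquiv.refl → ∀ τ : F →+* ℂ,
          {φ : L →+* ℂ | φ.comp (algebraMap F L) = τ.comp σ.toRingEquiv.toRingHom ∧ φ ∈ Φ.1}.ncard =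
            {φ : L →+* ℂ | φ.comp (algebraMap F L) = τ ∧ φ ∈ Φ.1}.ncard)
    (hM : ∀ F : IntermediateField ℚ L, Module.finrank ℚ F = 2 * 3 ^ 2 → ¬ IsTotallyReal F → IsCyclic (F ≃ₐ[ℚ] F) →
        ¬ ∀ σ : F ≃ₐ[ℚ] F, σ ^ (3 : ℕ) = AlgEquiv.refl → ∀ τ : F →+* ℂ,
          {φ : L →+* ℂ | φ.comp (algebraMap F L) = τ.comp σ.toRingEquiv.toRingHom ∧ φ ∈ Φ.1}.ncard =
            {φ : L →+* ℂ | φ.comp (algebraMap F L) = τ ∧ φ ∈ Φ.1}.ncard)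
    (hA : IsCMTypeRealisation Φ A ι θ) (n : ℕ) :
    HodgeConjectureFor (⨁ fun _ : Fin n => A).dim (⨁ fun _ : Fin n => A).X :=
  haveI : Fact (Nat.Prime 3) := ⟨Nat.prime_three⟩
  hodgeConjectureFor_pow_of_forall_of_isCyclotomicExtension (q := 108) (by norm_num) (by decide) units_pow_eighteen_oneHundredEight
    hW hL hM hA n

end Cyclotomic

end ExponentTwicePrimeSquare

end Literature.AlgebraicGeometry.Pohlmann1968

end
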